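import Mathlib
import HarnessLib
import Summits.Ventures.LatticeQCDFlow.Scaling.AutoregressiveProposalAcceptanceChain
import Summits.Ventures.LatticeQCDFlow.Scaling.AutoregressiveProposalKLChain
import Summits.Ventures.LatticeQCDFlow.Scaling.AutoregressiveGaugeForestAcceptance
import Summits.Ventures.LatticeQCDFlow.Scaling.AutoregressiveProposalAcceptanceInstances

/-!
# LatticeQCDFlow / Scaling — NECESSITY, MULTIPLICATIVE: along a generation order, UNIFORM per-coordinate
# affinity deficits MULTIPLY, so an exact sampler whose conditionals are uniformly wrong at `m`
# coordinates accepts at rate `≤ ∏_k θ_k² ≤ exp(−2 Σ_k (1 − θ_k))` — exponentially small in `m`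

HONEST FRAMING: exact (Metropolis-corrected) sampling algorithms for lattice gauge theory;
figures of merit are autocorrelation/cost numbers at stated couplings and volumes; no
continuum-physics claim.

Venture `LatticeQCDFlow` (cell pub-lqcd), topic `Scaling`, FANOUT row 30 (lean-1, GEN-20) — OUR WORK on
THEORY-2.md §4 row C5, companion of `Scaling/AutoregressiveProposalAcceptanceChain` (SUFFICIENCY,
`ā ≥ (1 − Σ/2Z)²`; `…KLAcceptanceFloor`: `ā ≥ ½e^{−2Σκ}`) and of `Scaling/AutoregressiveProposalAcceptance`
(NECESSITY at ONE coordinate, `ā ≤ 1 − δ_a/4`).  Here NECESSITY ALONG THE WHOLE ORDER, in the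
multiplicative (Bhattacharyya / Hellinger) currency in which per-coordinate deficits compound.

## Setting

`π = ⊗_ι μ` on `ι → X` (`μ` a probability measure), bounded measurable target weight `F ≥ 0`,
`Z = ∫ F dπ > 0`.  A block `l = [a₁, …, a_m]` of distinct coordinates in generation order with
conditionals `q_{a_k} ≥ 0` (bounded measurable, autoregressive along `l`: `q_{a_k}` does not read the later
coordinates — `l.Pairwise`), `s_k = {a_{k+1}, …, a_m}`; the hybrid proposal
`H_l = (∏_k q_{a_k})·A_{s_0}F/Z` (context exact, block from the model; the full model when `l` lists every
coordinate, and — by `Scaling/AutoregressiveProposalAcceptanceInstances` — EVERY proposal law bounded away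
from `0` and `∞` is such a product of its own conditionals, in any order).  The exact conditional density
of `ω_{a_k}` given the context and the earlier block coordinates is `A_{s_k}F(ω)/A_{s_{k−1}}F(ω)` as a
function of `ω_{a_k}`; its BHATTACHARYYA AFFINITY to the model's conditional at the context `ω` is
`(A_{s_{k−1}}F(ω))^{−1/2} ∫ √(q_{a_k} · A_{s_k}F)(ω[a_k ↦ v]) dμ(v) ∈ [0, 1]`.
HYPOTHESIS (a UNIFORM deficit at each step): for every context `ω`,
`∫ √(q_{a_k} · A_{s_k}F)(ω[a_k ↦ v]) dμ(v) ≤ θ_{a_k} · √(A_{s_{k−1}}F(ω))` — always true with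
`θ = 1` (§4, Cauchy–Schwarz); content when `θ_{a_k} < 1`.

## What is proved (all [ours]; elementary over the parents)

* §1 bookkeeping (`√(F·∏q)` is bounded measurable); the head-first tower `A_{insert a s} h(ω) =
  ∫ A_s h(ω[a ↦ v]) dμ(v)` is the tree's `coordAvg_insert_eq_integral_coordAvg_update` (`…Instances`).
* §2 **`coordAvg_sqrt_arProd_le_prod`** (THE MULTIPLICATIVE CHAIN, pointwise in the context):
  `A_{s_0}(√(F · ∏_k q_{a_k}))(ω) ≤ (∏_k θ_{a_k}) · √(A_{s_0}F(ω))` — induction along the order: the head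
  conditional is blind to the tail, so it factors out of the tail average; the tail is the induction
  hypothesis; the head integral is the hypothesis at the head.
* §3 **`integral_sqrt_arHybrid_le_prod`**: the Bhattacharyya coefficient of target and hybrid obeys
  `∫ √((F/Z)·H_l) dπ ≤ ∏_k θ_{a_k}`;  **`meanAccept_arHybrid_le_prod_sq`**: with the tree's `ā ≤ BC²`
  (`Scaling/AutoregressiveGaugeForestAcceptance.meanAccept_le_sq_integral_sqrt`) the equilibrium acceptance
  of the exact independence-Metropolis sampler with target `F/Z` and proposal `H_l` satisfies
  `ā ≤ (∏_k θ_{a_k})²`;  `prod_le_exp_neg_sum_one_sub`, **`meanAccept_arHybrid_le_exp`**: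
  `ā ≤ exp(−2 Σ_k (1 − θ_{a_k}))`.
* §4 `step_affinity_le` — the hypothesis always holds with `θ = 1` (it is a DEFICIT hypothesis).

READING (value-free): the log-acceptance of an exact autoregressive / flow sampler is at most
`−2 Σ_k (1 − θ_k)`, the sum over the generation order of the UNIFORM (worst-context is best-case here:
infimum over contexts) Hellinger-type affinity deficits of its conditionals; `m` coordinates whose
conditionals are uniformly wrong by `δ` force `ā ≤ e^{−2mδ}` — EXTENSIVE REJECTION.  Together with the
sufficiency files this pins the shape of the law: summable per-coordinate conditional divergences are
what an `O(1)` acceptance requires and what it costs.  NOT CLAIMED: a deficit that is only present ON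
AVERAGE over contexts does not chain this way (the single-coordinate file is the right statement there);
no explicit `θ < 1` is computed here for any gauge architecture; nothing on autocorrelations beyond the
acceptance.  No `def`, no `sorry`, nothing cited as a fact.
-/

noncomputable section

namespace Summit.Ventures.LatticeQCDFlow.Theory2.Autoregressive

open MeasureTheory Function Set
open Summit.Ventures.LatticeQCDFlow.Exactness

variable {ι : Type*} [Fintype ι] [DecidableEq ι] {X : Type*} [MeasurableSpace X]
variable (μ : Measure X) [IsProbabilityMeasure μ]

/-! ## §1 Toolbox -/

omit [Fintype ι] [DecidableEq ι] [MeasurableSpace X] [IsProbabilityMeasure μ] in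
/-- `√(F · ∏_l q)` is measurable, non-negative and bounded by `√(C_F · C_q^{|l|})`. [ours] -/
theorem sqrt_mul_arProd_props [MeasurableSpace X] {q : ι → (ι → X) → ℝ} (hqm : ∀ a, Measurable (q a))
    (hq0 : ∀ a ω, 0 ≤ q a ω) {Cq : ℝ} (hqb : ∀ a ω, q a ω ≤ Cq) (hCq : 0 ≤ Cq)
    {F : (ι → X) → ℝ} (hFm : Measurable F) (hF0 : ∀ ω, 0 ≤ F ω) {CF : ℝ} (hFb : ∀ ω, F ω ≤ CF)
    (l : List ι) :
    (Measurable fun η => Real.sqrt (F η * (l.map fun b => q b η).prod)) ∧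
      (∀ η, 0 ≤ Real.sqrt (F η * (l.map fun b => q b η).prod)) ∧
      ∀ η, |Real.sqrt (F η * (l.map fun b => q b η).prod)| ≤ Real.sqrt (CF * Cq ^ l.length) := by
  obtain ⟨hPm, hP0, hPb⟩ := arProd_props hqm hq0 hqb hCq l
  refine ⟨(hFm.mul hPm).sqrt, fun η => Real.sqrt_nonneg _, fun η => ?_⟩
  rw [abs_of_nonneg (Real.sqrt_nonneg _)]
  exact Real.sqrt_le_sqrt (mul_le_mul (hFb η) (hPb η) (hP0 η) ((hF0 η).trans (hFb η)))

/-! ## §2 The multiplicative chain -/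

/-- **THE MULTIPLICATIVE CHAIN (pointwise in the context).**  Conditionals `q_a ≥ 0` bounded measurable,
autoregressive along the block `l` of distinct coordinates; target weight `F ≥ 0` bounded measurable;
`θ ≥ 0`.  If at every step `(a_k, s_k)` of the order and every context `ω`
`∫ √(q_{a_k} · A_{s_k}F)(ω[a_k ↦ v]) dμ(v) ≤ θ_{a_k} √(A_{s_{k−1}}F(ω))`, then for every `ω`
`A_{s_0}(√(F · ∏_k q_{a_k}))(ω) ≤ (∏_k θ_{a_k}) · √(A_{s_0}F(ω))`. [ours] -/
theorem coordAvg_sqrt_arProd_le_prod {q : ι → (ι → X) → ℝ} (hqm : ∀ a, Measurable (q a))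
    (hq0 : ∀ a ω, 0 ≤ q a ω) {Cq : ℝ} (hqb : ∀ a ω, q a ω ≤ Cq) (hCq : 0 ≤ Cq)
    {F : (ι → X) → ℝ} (hFm : Measurable F) (hF0 : ∀ ω, 0 ≤ F ω) {CF : ℝ} (hFb : ∀ ω, F ω ≤ CF)
    {θ : ι → ℝ} (hθ0 : ∀ a, 0 ≤ θ a) :
    ∀ (l : List ι), l.Nodup → l.Pairwise (fun a b => ∀ ω v, q a (update ω b v) = q a ω) →
      (∀ c ∈ l.zip l.tails.tail, ∀ ω : ι → X,
        ∫ v, Real.sqrt (q c.1 (update ω c.1 v) * coordAvg μ c.2.toFinset F (update ω c.1 v)) ∂μ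
          ≤ θ c.1 * Real.sqrt (coordAvg μ (c.1 :: c.2).toFinset F ω)) →
      ∀ ω : ι → X, coordAvg μ l.toFinset (fun η => Real.sqrt (F η * (l.map fun b => q b η).prod)) ω
          ≤ (l.map θ).prod * Real.sqrt (coordAvg μ l.toFinset F ω) := by
  have hFabs : ∀ ω, |F ω| ≤ CF := fun ω => by rw [abs_of_nonneg (hF0 ω)]; exact hFb ω
  intro l
  induction l with
  | nil =>
    intro _ _ _ ω
    simp only [List.toFinset_nil, List.map_nil, List.prod_nil, mul_one, one_mul, coordAvg_empty]
    exact le_rfl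
  | cons a l' ih =>
    intro hnd hpw hθ ω
    obtain ⟨ha, hnd'⟩ := List.nodup_cons.1 hnd
    obtain ⟨hab, hpw'⟩ := List.pairwise_cons.1 hpw
    have htails : l'.tails = l' :: l'.tails.tail := by cases l' <;> rfl
    have hzip : ((a :: l').zip (a :: l').tails.tail) = (a, l') :: (l'.zip l'.tails.tail) := by
      rw [List.tails_cons, List.tail_cons, htails, List.zip_cons_cons, ← htails]
    have hθ' : ∀ c ∈ l'.zip l'.tails.tail, ∀ ω : ι → X,
        ∫ v, Real.sqrt (q c.1 (update ω c.1 v) * coordAvg μ c.2.toFinset F (update ω c.1 v)) ∂μ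
          ≤ θ c.1 * Real.sqrt (coordAvg μ (c.1 :: c.2).toFinset F ω) :=
      fun c hc => hθ c (by rw [hzip]; exact List.mem_cons_of_mem _ hc)
    have hθa := hθ (a, l') (by rw [hzip]; exact List.mem_cons_self)
    dsimp only at hθa
    have IH := ih hnd' hpw' hθ'
    set L' : Finset ι := l'.toFinset with hL'
    have haL' : a ∉ L' := by rw [hL', List.mem_toFinset]; exact ha
    have hcons : (a :: l').toFinset = insert a L' := List.toFinset_cons
    set T : ℝ := (l'.map θ).prod with hT
    have hT0 : 0 ≤ T := by
      rw [hT]; exact List.prod_nonneg (fun x hx => by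
        obtain ⟨b, _, rfl⟩ := List.mem_map.1 hx; exact hθ0 b)
    -- the tail product and the two square roots
    obtain ⟨hgm, hg0, hgb⟩ := sqrt_mul_arProd_props hqm hq0 hqb hCq hFm hF0 hFb (a :: l')
    set g : (ι → X) → ℝ := fun η => Real.sqrt (F η * ((a :: l').map fun b => q b η).prod) with hg
    set g' : (ι → X) → ℝ := fun η => Real.sqrt (F η * (l'.map fun b => q b η).prod) with hg'
    -- `√q_a` is blind to the tail block
    have hqa_blind : ∀ ω ω' : ι → X, Real.sqrt (q a (L'.piecewise ω' ω)) = Real.sqrt (q a ω) := by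
      intro ω ω'
      rw [hL', blind_piecewise_of_forall_update (g := q a) l' hab ω ω']
    -- pointwise factorisation `g = √q_a · g'`
    have hfac : ∀ η, g η = Real.sqrt (q a η) * g' η := by
      intro η
      simp only [hg, hg', List.map_cons, List.prod_cons]
      rw [show F η * (q a η * (l'.map fun b => q b η).prod) = q a η * (F η * (l'.map fun b => q b η).prod)
        by ring, Real.sqrt_mul (hq0 a η)]
    -- the tail average of `g`, pointwise
    have htail : ∀ ω' : ι → X, coordAvg μ L' g ω' ≤ Real.sqrt (q a ω') * (T * Real.sqrt (coordAvg μ L' F ω')) := by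
      intro ω'
      have e : coordAvg μ L' g ω' = Real.sqrt (q a ω') * coordAvg μ L' g' ω' := by
        rw [show g = fun η => Real.sqrt (q a η) * g' η from funext hfac]
        exact coordAvg_mul_left μ L' hqa_blind ω'
      rw [e]
      exact mul_le_mul_of_nonneg_left (IH ω') (Real.sqrt_nonneg _)
    -- the head integral
    have hAm : Measurable (coordAvg μ L' F) := measurable_coordAvg μ L' hFm
    have hA0 : ∀ ω', 0 ≤ coordAvg μ L' F ω' := fun ω' => (coordAvg_mem_Icc μ L' hFm hF0 hFb ω').1
    have hAb : ∀ ω', |coordAvg μ L' F ω'| ≤ CF := abs_coordAvg_le_of_abs_le μ L' hFm hFabs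
    have hI1 : Integrable (fun v => coordAvg μ L' g (update ω a v)) μ :=
      integrable_of_bounded_measurable ((measurable_coordAvg μ L' hgm).comp (measurable_update ω))
        (fun v => abs_coordAvg_le_of_abs_le μ L' hgm hgb _)
    have hI2 : Integrable (fun v => Real.sqrt (q a (update ω a v)) *
        (T * Real.sqrt (coordAvg μ L' F (update ω a v)))) μ := by
      refine integrable_of_bounded_measurable
        ((((hqm a).comp (measurable_update ω)).sqrt).mul
          (measurable_const.mul ((hAm.comp (measurable_update ω)).sqrt)))
        (C := Real.sqrt Cq * (T * Real.sqrt CF)) (fun v => ?_)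
      rw [abs_mul, abs_mul, abs_of_nonneg (Real.sqrt_nonneg _), abs_of_nonneg hT0,
        abs_of_nonneg (Real.sqrt_nonneg _)]
      refine mul_le_mul (Real.sqrt_le_sqrt (hqb a _)) ?_ (mul_nonneg hT0 (Real.sqrt_nonneg _))
        (Real.sqrt_nonneg _)
      exact mul_le_mul_of_nonneg_left
        (Real.sqrt_le_sqrt ((le_abs_self _).trans (hAb _))) hT0
    calc coordAvg μ (a :: l').toFinset g ω
        = ∫ v, coordAvg μ L' g (update ω a v) ∂μ := by
          rw [hcons]; exact coordAvg_insert_eq_integral_coordAvg_update μ haL' hgm hgb ω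
      _ ≤ ∫ v, Real.sqrt (q a (update ω a v)) * (T * Real.sqrt (coordAvg μ L' F (update ω a v))) ∂μ :=
          integral_mono hI1 hI2 fun v => htail _
      _ = T * ∫ v, Real.sqrt (q a (update ω a v) * coordAvg μ L' F (update ω a v)) ∂μ := by
          rw [← integral_const_mul]
          refine integral_congr_ae (ae_of_all _ fun v => ?_)
          dsimp only
          rw [Real.sqrt_mul (hq0 a _)]
          ring
      _ ≤ T * (θ a * Real.sqrt (coordAvg μ (a :: l').toFinset F ω)) :=
          mul_le_mul_of_nonneg_left (hθa ω) hT0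
      _ = ((a :: l').map θ).prod * Real.sqrt (coordAvg μ (a :: l').toFinset F ω) := by
          simp only [List.map_cons, List.prod_cons, hT]
          ring

/-! ## §3 The Bhattacharyya coefficient and the acceptance -/

/-- **`BC(target, hybrid) ≤ ∏_k θ_{a_k}`**: under the hypotheses of `coordAvg_sqrt_arProd_le_prod` and
`Z = ∫ F dπ > 0`, `∫ √((F/Z) · (∏_k q_{a_k}) A_{s_0}F / Z) dπ ≤ ∏_k θ_{a_k}`. [ours] -/
theorem integral_sqrt_arHybrid_le_prod {q : ι → (ι → X) → ℝ} (hqm : ∀ a, Measurable (q a))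
    (hq0 : ∀ a ω, 0 ≤ q a ω) {Cq : ℝ} (hqb : ∀ a ω, q a ω ≤ Cq) (hCq : 0 ≤ Cq)
    {F : (ι → X) → ℝ} (hFm : Measurable F) (hF0 : ∀ ω, 0 ≤ F ω) {CF : ℝ} (hFb : ∀ ω, F ω ≤ CF)
    (hZ : 0 < ∫ ω, F ω ∂Measure.pi (fun _ : ι => μ))
    {θ : ι → ℝ} (hθ0 : ∀ a, 0 ≤ θ a) (l : List ι) (hl : l.Nodup)
    (hpw : l.Pairwise (fun a b => ∀ ω v, q a (update ω b v) = q a ω))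
    (hθ : ∀ c ∈ l.zip l.tails.tail, ∀ ω : ι → X,
        ∫ v, Real.sqrt (q c.1 (update ω c.1 v) * coordAvg μ c.2.toFinset F (update ω c.1 v)) ∂μ
          ≤ θ c.1 * Real.sqrt (coordAvg μ (c.1 :: c.2).toFinset F ω)) :
    ∫ ω, Real.sqrt (F ω / (∫ ω, F ω ∂Measure.pi (fun _ : ι => μ)) *
        ((l.map fun b => q b ω).prod * coordAvg μ l.toFinset F ω /
          ∫ ω, F ω ∂Measure.pi (fun _ : ι => μ))) ∂Measure.pi (fun _ : ι => μ)
      ≤ (l.map θ).prod := by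
  set Z : ℝ := ∫ ω, F ω ∂Measure.pi (fun _ : ι => μ) with hZdef
  set L : Finset ι := l.toFinset with hL
  set T : ℝ := (l.map θ).prod with hT
  have hFabs : ∀ ω, |F ω| ≤ CF := fun ω => by rw [abs_of_nonneg (hF0 ω)]; exact hFb ω
  obtain ⟨hgm, hg0, hgb⟩ := sqrt_mul_arProd_props hqm hq0 hqb hCq hFm hF0 hFb l
  set g : (ι → X) → ℝ := fun η => Real.sqrt (F η * (l.map fun b => q b η).prod) with hg
  set A : (ι → X) → ℝ := coordAvg μ L F with hA
  have hAm : Measurable A := measurable_coordAvg μ L hFm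
  have hA0 : ∀ ω, 0 ≤ A ω := fun ω => (coordAvg_mem_Icc μ L hFm hF0 hFb ω).1
  have hAb : ∀ ω, |A ω| ≤ CF := abs_coordAvg_le_of_abs_le μ L hFm hFabs
  have hΦm : Measurable fun ω => Real.sqrt (A ω) := hAm.sqrt
  have hΦb : ∀ ω, |Real.sqrt (A ω)| ≤ Real.sqrt CF := fun ω => by
    rw [abs_of_nonneg (Real.sqrt_nonneg _)]
    exact Real.sqrt_le_sqrt ((le_abs_self _).trans (hAb ω))
  have hΦs : ∀ ω ω', Real.sqrt (A (L.piecewise ω' ω)) = Real.sqrt (A ω) := fun ω ω' => by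
    rw [hA, coordAvg_apply_piecewise]
  have hpt : ∀ ω, Real.sqrt (F ω / Z * ((l.map fun b => q b ω).prod * A ω / Z))
      = Z⁻¹ * (Real.sqrt (A ω) * g ω) := by
    intro ω
    have e : F ω / Z * ((l.map fun b => q b ω).prod * A ω / Z)
        = (A ω * (F ω * (l.map fun b => q b ω).prod)) / Z ^ 2 := by
      rw [div_mul_div_comm, pow_two]
      congr 1
      ring
    rw [e, Real.sqrt_div' _ (sq_nonneg Z), Real.sqrt_sq hZ.le, Real.sqrt_mul (hA0 ω), hg]
    ring
  -- the chain, pointwise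
  have hchain : ∀ ω, coordAvg μ L g ω ≤ T * Real.sqrt (A ω) :=
    coordAvg_sqrt_arProd_le_prod μ hqm hq0 hqb hCq hFm hF0 hFb hθ0 l hl hpw hθ
  have hI1 : Integrable (fun ω => Real.sqrt (A ω) * coordAvg μ L g ω) (Measure.pi fun _ : ι => μ) :=
    integrable_pi_of_abs_le μ (hΦm.mul (measurable_coordAvg μ L hgm))
      (C := Real.sqrt CF * Real.sqrt (CF * Cq ^ l.length)) (fun ω => by
        rw [abs_mul]
        exact mul_le_mul (hΦb ω) (abs_coordAvg_le_of_abs_le μ L hgm hgb ω) (abs_nonneg _)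
          (Real.sqrt_nonneg _))
  have hI2 : Integrable (fun ω => T * A ω) (Measure.pi fun _ : ι => μ) :=
    (integrable_pi_of_abs_le μ hAm hAb).const_mul T
  calc ∫ ω, Real.sqrt (F ω / Z * ((l.map fun b => q b ω).prod * A ω / Z)) ∂Measure.pi (fun _ : ι => μ)
      = Z⁻¹ * ∫ ω, Real.sqrt (A ω) * g ω ∂Measure.pi (fun _ : ι => μ) := by
        rw [← integral_const_mul]
        exact integral_congr_ae (ae_of_all _ hpt)
    _ = Z⁻¹ * ∫ ω, Real.sqrt (A ω) * coordAvg μ L g ω ∂Measure.pi (fun _ : ι => μ) := by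
        rw [pi_integral_mul_coordAvg μ L hgm hgb hΦm hΦb hΦs]
    _ ≤ Z⁻¹ * ∫ ω, T * A ω ∂Measure.pi (fun _ : ι => μ) := by
        refine mul_le_mul_of_nonneg_left (integral_mono hI1 hI2 fun ω => ?_) (inv_pos.2 hZ).le
        calc Real.sqrt (A ω) * coordAvg μ L g ω ≤ Real.sqrt (A ω) * (T * Real.sqrt (A ω)) :=
              mul_le_mul_of_nonneg_left (hchain ω) (Real.sqrt_nonneg _)
          _ = T * A ω := by
              rw [← mul_assoc, mul_comm (Real.sqrt (A ω)) T, mul_assoc, Real.mul_self_sqrt (hA0 ω)]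
    _ = Z⁻¹ * (T * Z) := by
        rw [integral_const_mul, hA, hL, pi_integral_coordAvg μ l.toFinset hFm hFabs]
    _ = T := by
        field_simp

/-- **THE ACCEPTANCE CEILING, MULTIPLICATIVE FORM.**  Under the hypotheses of
`integral_sqrt_arHybrid_le_prod`, the equilibrium acceptance of the exact independence-Metropolis sampler
with target `F/Z` and the hybrid proposal `H_l = (∏_k q_{a_k})·A_{s_0}F/Z` satisfies
`ā = ∫∫ min((F(x)/Z)H_l(y), (F(y)/Z)H_l(x)) dπ dπ ≤ (∏_k θ_{a_k})²`. [ours] -/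
theorem meanAccept_arHybrid_le_prod_sq {q : ι → (ι → X) → ℝ} (hqm : ∀ a, Measurable (q a))
    (hq0 : ∀ a ω, 0 ≤ q a ω) {Cq : ℝ} (hqb : ∀ a ω, q a ω ≤ Cq) (hCq : 0 ≤ Cq)
    {F : (ι → X) → ℝ} (hFm : Measurable F) (hF0 : ∀ ω, 0 ≤ F ω) {CF : ℝ} (hFb : ∀ ω, F ω ≤ CF)
    (hZ : 0 < ∫ ω, F ω ∂Measure.pi (fun _ : ι => μ))
    {θ : ι → ℝ} (hθ0 : ∀ a, 0 ≤ θ a) (l : List ι) (hl : l.Nodup)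
    (hpw : l.Pairwise (fun a b => ∀ ω v, q a (update ω b v) = q a ω))
    (hθ : ∀ c ∈ l.zip l.tails.tail, ∀ ω : ι → X,
        ∫ v, Real.sqrt (q c.1 (update ω c.1 v) * coordAvg μ c.2.toFinset F (update ω c.1 v)) ∂μ
          ≤ θ c.1 * Real.sqrt (coordAvg μ (c.1 :: c.2).toFinset F ω)) :
    ∫ x, ∫ y, min
        (F x / (∫ ω, F ω ∂Measure.pi (fun _ : ι => μ)) *
          ((l.map fun b => q b y).prod * coordAvg μ l.toFinset F y /
            ∫ ω, F ω ∂Measure.pi (fun _ : ι => μ)))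
        (F y / (∫ ω, F ω ∂Measure.pi (fun _ : ι => μ)) *
          ((l.map fun b => q b x).prod * coordAvg μ l.toFinset F x /
            ∫ ω, F ω ∂Measure.pi (fun _ : ι => μ)))
        ∂Measure.pi (fun _ : ι => μ) ∂Measure.pi (fun _ : ι => μ)
      ≤ ((l.map θ).prod) ^ 2 := by
  set Z : ℝ := ∫ ω, F ω ∂Measure.pi (fun _ : ι => μ) with hZdef
  set L : Finset ι := l.toFinset with hL
  obtain ⟨hPm, hP0, hPb⟩ := arProd_props hqm hq0 hqb hCq l
  have hA0 : ∀ ω, 0 ≤ coordAvg μ L F ω := fun ω => (coordAvg_mem_Icc μ L hFm hF0 hFb ω).1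
  have hA1 : ∀ ω, coordAvg μ L F ω ≤ CF := fun ω => (coordAvg_mem_Icc μ L hFm hF0 hFb ω).2
  -- densities
  have hpm : Measurable fun ω => F ω / Z := hFm.div_const Z
  have hp0 : ∀ ω, 0 ≤ F ω / Z := fun ω => div_nonneg (hF0 ω) hZ.le
  have hpb : ∀ ω, F ω / Z ≤ CF / Z := fun ω => div_le_div_of_nonneg_right (hFb ω) hZ.le
  have hHm : Measurable fun ω => (l.map fun b => q b ω).prod * coordAvg μ L F ω / Z :=
    (hPm.mul (measurable_coordAvg μ L hFm)).div_const Z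
  have hH0 : ∀ ω, 0 ≤ (l.map fun b => q b ω).prod * coordAvg μ L F ω / Z := fun ω =>
    div_nonneg (mul_nonneg (hP0 ω) (hA0 ω)) hZ.le
  have hHb : ∀ ω, (l.map fun b => q b ω).prod * coordAvg μ L F ω / Z ≤ Cq ^ l.length * CF / Z :=
    fun ω => div_le_div_of_nonneg_right (mul_le_mul (hPb ω) (hA1 ω) (hA0 ω) (pow_nonneg hCq _)) hZ.le
  have h1 := meanAccept_le_sq_integral_sqrt (Measure.pi fun _ : ι => μ) hp0 hpm hpb hH0 hHm hHb
  have h2 := integral_sqrt_arHybrid_le_prod μ hqm hq0 hqb hCq hFm hF0 hFb hZ hθ0 l hl hpw hθ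
  have h3 : 0 ≤ ∫ ω, Real.sqrt (F ω / Z * ((l.map fun b => q b ω).prod * coordAvg μ L F ω / Z))
      ∂Measure.pi (fun _ : ι => μ) := integral_nonneg fun ω => Real.sqrt_nonneg _
  exact h1.trans (pow_le_pow_left₀ h3 h2 2)

omit [Fintype ι] [DecidableEq ι] [MeasurableSpace X] [IsProbabilityMeasure μ] in
/-- `∏_k θ_k ≤ exp(−Σ_k (1 − θ_k))` for `θ_k ≥ 0` (`θ ≤ e^{θ − 1}`). [folklore] -/
theorem prod_le_exp_neg_sum_one_sub {θ : ι → ℝ} (hθ0 : ∀ a, 0 ≤ θ a) :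
    ∀ l : List ι, (l.map θ).prod ≤ Real.exp (-(l.map fun a => 1 - θ a).sum) := by
  intro l
  induction l with
  | nil => simp
  | cons a l' ih =>
    simp only [List.map_cons, List.prod_cons, List.sum_cons, neg_add, Real.exp_add]
    have h1 : θ a ≤ Real.exp (-(1 - θ a)) := by
      have := Real.add_one_le_exp (θ a - 1)
      rw [show -(1 - θ a) = θ a - 1 by ring]
      linarith
    have hT0 : 0 ≤ (l'.map θ).prod := List.prod_nonneg (fun x hx => by
      obtain ⟨b, _, rfl⟩ := List.mem_map.1 hx; exact hθ0 b)
    exact mul_le_mul h1 ih hT0 (Real.exp_pos _).le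

/-- **THE ACCEPTANCE CEILING, EXPONENTIAL FORM**: under the hypotheses of
`meanAccept_arHybrid_le_prod_sq`, `ā ≤ exp(−2 Σ_k (1 − θ_{a_k}))` — `m` coordinates with a uniform
affinity deficit `1 − θ ≥ δ` force `ā ≤ e^{−2mδ}`. [ours] -/
theorem meanAccept_arHybrid_le_exp {q : ι → (ι → X) → ℝ} (hqm : ∀ a, Measurable (q a))
    (hq0 : ∀ a ω, 0 ≤ q a ω) {Cq : ℝ} (hqb : ∀ a ω, q a ω ≤ Cq) (hCq : 0 ≤ Cq)
    {F : (ι → X) → ℝ} (hFm : Measurable F) (hF0 : ∀ ω, 0 ≤ F ω) {CF : ℝ} (hFb : ∀ ω, F ω ≤ CF)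
    (hZ : 0 < ∫ ω, F ω ∂Measure.pi (fun _ : ι => μ))
    {θ : ι → ℝ} (hθ0 : ∀ a, 0 ≤ θ a) (l : List ι) (hl : l.Nodup)
    (hpw : l.Pairwise (fun a b => ∀ ω v, q a (update ω b v) = q a ω))
    (hθ : ∀ c ∈ l.zip l.tails.tail, ∀ ω : ι → X,
        ∫ v, Real.sqrt (q c.1 (update ω c.1 v) * coordAvg μ c.2.toFinset F (update ω c.1 v)) ∂μ
          ≤ θ c.1 * Real.sqrt (coordAvg μ (c.1 :: c.2).toFinset F ω)) :
    ∫ x, ∫ y, min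
        (F x / (∫ ω, F ω ∂Measure.pi (fun _ : ι => μ)) *
          ((l.map fun b => q b y).prod * coordAvg μ l.toFinset F y /
            ∫ ω, F ω ∂Measure.pi (fun _ : ι => μ)))
        (F y / (∫ ω, F ω ∂Measure.pi (fun _ : ι => μ)) *
          ((l.map fun b => q b x).prod * coordAvg μ l.toFinset F x /
            ∫ ω, F ω ∂Measure.pi (fun _ : ι => μ)))
        ∂Measure.pi (fun _ : ι => μ) ∂Measure.pi (fun _ : ι => μ)
      ≤ Real.exp (-2 * (l.map fun a => 1 - θ a).sum) := by
  have h1 := meanAccept_arHybrid_le_prod_sq μ hqm hq0 hqb hCq hFm hF0 hFb hZ hθ0 l hl hpw hθ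
  have h2 := prod_le_exp_neg_sum_one_sub hθ0 l
  have hT0 : 0 ≤ (l.map θ).prod := List.prod_nonneg (fun x hx => by
    obtain ⟨b, _, rfl⟩ := List.mem_map.1 hx; exact hθ0 b)
  have h3 : ((l.map θ).prod) ^ 2 ≤ (Real.exp (-(l.map fun a => 1 - θ a).sum)) ^ 2 :=
    pow_le_pow_left₀ hT0 h2 2
  rw [← Real.exp_nat_mul] at h3
  refine h1.trans (h3.trans (le_of_eq ?_))
  congr 1
  push_cast
  ring

/-! ## §4 The hypothesis is a deficit hypothesis: it always holds with `θ = 1` -/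

/-- **Affinities never exceed one**: for `q_a ≥ 0` bounded measurable and normalised in `a`, a bounded
measurable `G ≥ 0` and any `s`, `∫ √(q_a · A_sG)(ω[a ↦ v]) dμ(v) ≤ √(A_{insert a s}G(ω))` whenever
`a ∉ s` (Cauchy–Schwarz in the coordinate `a`).  So `θ ≡ 1` always satisfies the step hypothesis of
`coordAvg_sqrt_arProd_le_prod`; its content is `θ < 1`. [ours] -/
theorem step_affinity_le {a : ι} {s : Finset ι} (ha : a ∉ s) {qa G : (ι → X) → ℝ}
    (hqm : Measurable qa) (hq0 : ∀ ω, 0 ≤ qa ω) {Cq : ℝ} (hqb : ∀ ω, qa ω ≤ Cq)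
    (hq1 : ∀ ω, ∫ v, qa (update ω a v) ∂μ = 1)
    (hGm : Measurable G) (hG0 : ∀ ω, 0 ≤ G ω) {CG : ℝ} (hGb : ∀ ω, G ω ≤ CG) (ω : ι → X) :
    ∫ v, Real.sqrt (qa (update ω a v) * coordAvg μ s G (update ω a v)) ∂μ
      ≤ Real.sqrt (coordAvg μ (insert a s) G ω) := by
  have hGabs : ∀ ω, |G ω| ≤ CG := fun ω => by rw [abs_of_nonneg (hG0 ω)]; exact hGb ω
  have hAm : Measurable (coordAvg μ s G) := measurable_coordAvg μ s hGm
  have hA0 : ∀ ω, 0 ≤ coordAvg μ s G ω := fun ω => (coordAvg_mem_Icc μ s hGm hG0 hGb ω).1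
  have hA1 : ∀ ω, coordAvg μ s G ω ≤ CG := fun ω => (coordAvg_mem_Icc μ s hGm hG0 hGb ω).2
  -- Cauchy–Schwarz along the coordinate `a`
  have hcs := coordAvg_sqrt_mul_le μ {a} hqm hq0 hqb hAm hA0 hA1 ω
  have e1 : coordAvg μ {a} (fun η => Real.sqrt (qa η * coordAvg μ s G η)) ω
      = ∫ v, Real.sqrt (qa (update ω a v) * coordAvg μ s G (update ω a v)) ∂μ :=
    coordAvg_singleton_of_measurable μ a (hqm.mul hAm).sqrt ω
  have e2 : coordAvg μ {a} qa ω = 1 := by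
    rw [coordAvg_singleton_of_measurable μ a hqm ω, hq1 ω]
  have e3 : coordAvg μ {a} (coordAvg μ s G) ω = coordAvg μ (insert a s) G ω := by
    rw [coordAvg_singleton_of_measurable μ a hAm ω, coordAvg_insert_eq_integral_coordAvg_update μ ha hGm hGabs ω]
  rw [e1, e2, e3, one_mul] at hcs
  exact hcs

end Summit.Ventures.LatticeQCDFlow.Theory2.Autoregressive

end
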